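import Summits.Ventures.LatticeQCDFlow.Scaling.SimulatedTemperingExactLevelLaw
import Summits.Ventures.LatticeQCDFlow.TrivializingMaps.SpecificHeatCeilingTwoDim
import Summits.Ventures.LatticeQCDFlow.TrivializingMaps.SpecificHeatFloorTwoDim

/-!
HONEST FRAMING: exact (Metropolis-corrected) sampling algorithms for lattice gauge theory; figures
of merit are autocorrelation/cost numbers at stated couplings and volumes; no continuum-physics
claim.

# SimulatedTemperingExactLadderLaws — (1) THE LADDER-SIZE-FREE FLOOR IS ATTAINED: WITH `K* = ⌈(b−a)√M⌉` LEVELS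
# THE SAMPLER DECORRELATES ITS COUPLING AT RATE `≥ 6e^{−2}/(((b−a)√M+2)((b−a)√M+3))`; (2) IN TWO DIMENSIONS THE
# WILSON SAMPLER OF EVERY COMPACT GAUGE GROUP IS EXACTLY DIFFUSIVE WITH VOLUME-UNIFORM CONSTANTS ON BOTH SIDES
# (lean-2 GEN-14, ours)

Venture-side (OURS).  Cell `lqcd-flow` (pub-lqcd), unit `pub-lqcd-lean-2-g14`, 2026-08-24.  Two corollaries of the
two-sided ladder law of `Scaling/SimulatedTemperingExactLevelLaw`
(`6e^{−(Δ√M+MΔ²)} ≤ (K+1)(K+2)(1−ρ_lev(1)) ≤ 6e^{−mΔ²/8}` for the constructed sampler `W ∘ₖ L` on a uniform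
ladder with a variance floor `m` and ceiling `M`, `Δ = (b−a)/K`).
§1 chooses the number of levels: with `K* = ⌈(b−a)√M⌉` one has `Δ√M ≤ 1`, hence
`1 − ρ_lev(1) ≥ 6e^{−2}/((K*+1)(K*+2)) ≥ 6e^{−2}/(((b−a)√M+2)((b−a)√M+3))` — order `1/(M(b−a)²)`: GEN-13's
ladder-size-free floor `1 − ρ_lev(1) ≤ 96/(e·m·(b−a)²)` (no number of levels does better) is ACHIEVED by the
textbook sampler with `√(heat capacity) × window` levels, up to the ratio `M/m`.  §2 docks both sides to the
TWO-DIMENSIONAL Wilson measure, where GEN-12 pinched the specific heat at every coupling for every compact gauge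
group: `½e^{−4N|β|}(L²−1)Var_Haar(Re tr ρ) − N² ≤ Var_β(S_W) ≤ 2N²e^{2N|β|}L²`
(`TrivializingMaps/SpecificHeatFloorTwoDim`, `…CeilingTwoDim`).

## What is proved

* §1 `natCeil_window_pos`, `window_div_ceil_mul_sqrt_le_one`;
  **`stScan_one_sub_lagOneAutocorr_ge_optimalLadder`** — `μ` probability, `X` bounded measurable, `a < b`,
  `0 < M`, `Var_{μ_u}(X) ≤ M` on `[a,b]`, `M_k` any Markov kernels: for `W ∘ₖ L` on the uniform ladder with
  `K* = ⌈(b−a)√M⌉₊` steps, `6·e^{−2}/(((b−a)√M + 2)((b−a)√M + 3)) ≤ 1 − ρ_lev(1)`.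
* §3 `st_overlap_pos`, `st_abar_pos` (`ā_K > 0`), **`stScan_level_lagOneAutocorr_lt_one`** — the sampler is
  never frozen at lag one (`ρ_lev(1) < 1`, the proviso of the `τ_int` floors).
* §2 **`wilson_stScan_one_sub_lagOneAutocorr_twoSided_twoDim`** — `d = 2`, any compact second-countable `G`,
  continuous `ρ`, `L ≥ 2`, `−B ≤ a < b ≤ B`, `K ≥ 1`, `Δ = (b−a)/K`, `M k` ANY Markov kernels; with
  `m₂ = e^{−4NB}(L²−1)Var_Haar(Re tr ρ)/2 − N²`, `M₂ = 2N²e^{2NB}L²`: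
  `6·e^{−(Δ√M₂ + M₂Δ²)}/((K+1)(K+2)) ≤ 1 − ρ_lev(1) ≤ 6·e^{−m₂Δ²/8}/((K+1)(K+2))` for the 2-d Wilson sampler.

NOT CLAIMED: optimality of `K*` among ladders (order only); `d ≥ 3` (no volume-uniform ceiling in the tree);
sharp constants; anything measured.  Literature grade (cell rule): KNOWN HEURISTIC / MECHANISM (`√C_V`-spaced
ladders — Hukushima–Nemoto 1996, Kofke 2002, Katzgraber–Trebst–Huse–Troyer 2006), NEW TYPING (theorems for the
constructed kernel); nothing cited as a fact.
-/

noncomputable section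

open MeasureTheory ProbabilityTheory Set Filter Finset
open Literature.MathematicalPhysics.QuantumFieldTheory
open Literature.MathematicalPhysics.QuantumFieldTheory.Luscher2010
open Summit.Ventures.LatticeQCDFlow.Scoring
open Summit.Ventures.LatticeQCDFlow.TrivializingMaps
open scoped ENNReal

namespace Summit.Ventures.LatticeQCDFlow.Scaling

/-! ## §1 The ladder-size-free floor is attained -/

section Optimal

/-- `K* = ⌈(b−a)√M⌉₊ ≥ 1` for `a < b`, `M > 0`. [folklore] -/
theorem natCeil_window_pos {a b M : ℝ} (hab : a < b) (hM : 0 < M) : 1 ≤ ⌈(b - a) * Real.sqrt M⌉₊ := by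
  have h : 0 < (b - a) * Real.sqrt M := mul_pos (sub_pos.2 hab) (Real.sqrt_pos.2 hM)
  exact Nat.one_le_iff_ne_zero.2 (by
    intro h0
    have := Nat.ceil_eq_zero.1 h0
    linarith)

/-- With `K* = ⌈(b−a)√M⌉₊` levels the rung spacing satisfies `Δ√M ≤ 1`, `Δ = (b−a)/K*`. [folklore] -/
theorem window_div_ceil_mul_sqrt_le_one {a b M : ℝ} (hab : a < b) (hM : 0 < M) :
    (b - a) / ⌈(b - a) * Real.sqrt M⌉₊ * Real.sqrt M ≤ 1 := by
  have hs : 0 < Real.sqrt M := Real.sqrt_pos.2 hM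
  have hK : 0 < ((⌈(b - a) * Real.sqrt M⌉₊ : ℕ) : ℝ) := by
    have := natCeil_window_pos hab hM
    exact_mod_cast Nat.lt_of_lt_of_le Nat.zero_lt_one this
  rw [div_mul_eq_mul_div, div_le_one hK]
  exact Nat.le_ceil _

variable {Ω : Type*} [MeasurableSpace Ω] {X : Ω → ℝ} {μ : Measure Ω} [IsProbabilityMeasure μ]

/-- **THE LADDER-SIZE-FREE RATE IS ATTAINED WITH `K* = ⌈(b−a)√M⌉` LEVELS.**  `μ` a probability measure, `X` bounded
measurable, `a < b`, `0 < M` with `Var_{μ_u}(X) ≤ M` on `[a, b]`, `M_k` any Markov kernels on `Ω`.  For the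
simulated-tempering sampler `stWithinLevel M_k ∘ₖ stLevelKernel` on the uniform ladder from `a` to `b` with
`K* = ⌈(b−a)√M⌉₊` steps: `6·e^{−2}/(((b−a)√M + 2)·((b−a)√M + 3)) ≤ 1 − ρ_lev(1)`. [ours] -/
theorem stScan_one_sub_lagOneAutocorr_ge_optimalLadder (hXm : Measurable X) (hXb : ∃ C, ∀ x, |X x| ≤ C)
    {a b M : ℝ} (hab : a < b) (hM0 : 0 < M) (hM : ∀ u ∈ Icc a b, variance X (μ.tilted fun x => u * X x) ≤ M)
    (Mk : Fin (⌈(b - a) * Real.sqrt M⌉₊ + 1) → Kernel Ω Ω) [∀ k, IsMarkovKernel (Mk k)] :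
    6 * Real.exp (-2) / (((b - a) * Real.sqrt M + 2) * ((b - a) * Real.sqrt M + 3)) ≤
      1 - (autocov (stWithinLevel Mk ∘ₖ stLevelKernel hXm μ
              (fun k => a + k * ((b - a) / ⌈(b - a) * Real.sqrt M⌉₊)) ⌈(b - a) * Real.sqrt M⌉₊)
          (stTarget X μ (fun k => a + k * ((b - a) / ⌈(b - a) * Real.sqrt M⌉₊)) ⌈(b - a) * Real.sqrt M⌉₊)
          (fun z => (((z.1 : Fin (⌈(b - a) * Real.sqrt M⌉₊ + 1)) : ℕ) : ℝ)) 1 -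
            ((⌈(b - a) * Real.sqrt M⌉₊ : ℝ) / 2) ^ 2) /
        (⌈(b - a) * Real.sqrt M⌉₊ * (⌈(b - a) * Real.sqrt M⌉₊ + 2) / 12) := by
  have hK1 : 1 ≤ ⌈(b - a) * Real.sqrt M⌉₊ := natCeil_window_pos hab hM0
  -- any floor works for the lower side; use the trivial floor `m = 0`
  have hm : ∀ u ∈ Icc a b, (0 : ℝ) ≤ variance X (μ.tilted fun x => u * X x) := fun u _ => variance_nonneg _ _
  have h := (stScan_one_sub_lagOneAutocorr_twoSided (μ := μ) hXm hXb hab hm hM hK1 Mk).1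
  refine le_trans ?_ h
  -- `Δ√M ≤ 1` ⇒ exponent `≥ −2`; `(K+1)(K+2) ≤ ((b−a)√M+2)((b−a)√M+3)`
  have hs : 0 ≤ Real.sqrt M := Real.sqrt_nonneg M
  have hδ1 : (b - a) / ⌈(b - a) * Real.sqrt M⌉₊ * Real.sqrt M ≤ 1 := window_div_ceil_mul_sqrt_le_one hab hM0
  have hδ0 : 0 ≤ (b - a) / ⌈(b - a) * Real.sqrt M⌉₊ * Real.sqrt M :=
    mul_nonneg (div_nonneg (sub_nonneg.2 hab.le) (Nat.cast_nonneg _)) hs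
  have hexp : Real.exp (-2) ≤ Real.exp (-((b - a) / ⌈(b - a) * Real.sqrt M⌉₊ * Real.sqrt M +
      M * ((b - a) / ⌈(b - a) * Real.sqrt M⌉₊) ^ 2)) := by
    apply Real.exp_le_exp.2
    have e : M * ((b - a) / ⌈(b - a) * Real.sqrt M⌉₊) ^ 2 = ((b - a) / ⌈(b - a) * Real.sqrt M⌉₊ * Real.sqrt M) ^ 2 := by
      rw [mul_pow, Real.sq_sqrt hM0.le]; ring
    rw [e]
    nlinarith
  have hKle : ((⌈(b - a) * Real.sqrt M⌉₊ : ℕ) : ℝ) ≤ (b - a) * Real.sqrt M + 1 :=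
    (Nat.ceil_lt_add_one (mul_nonneg (sub_nonneg.2 hab.le) hs)).le
  have hK0 : (0 : ℝ) ≤ ((⌈(b - a) * Real.sqrt M⌉₊ : ℕ) : ℝ) := Nat.cast_nonneg _
  have hKpos : (0 : ℝ) < (((⌈(b - a) * Real.sqrt M⌉₊ : ℕ) : ℝ) + 1) * (((⌈(b - a) * Real.sqrt M⌉₊ : ℕ) : ℝ) + 2) := by
    positivity
  have hden : (((⌈(b - a) * Real.sqrt M⌉₊ : ℕ) : ℝ) + 1) * (((⌈(b - a) * Real.sqrt M⌉₊ : ℕ) : ℝ) + 2) ≤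
      ((b - a) * Real.sqrt M + 2) * ((b - a) * Real.sqrt M + 3) := by
    nlinarith
  calc 6 * Real.exp (-2) / (((b - a) * Real.sqrt M + 2) * ((b - a) * Real.sqrt M + 3))
      ≤ 6 * Real.exp (-2) / ((((⌈(b - a) * Real.sqrt M⌉₊ : ℕ) : ℝ) + 1) * (((⌈(b - a) * Real.sqrt M⌉₊ : ℕ) : ℝ) + 2)) :=
        div_le_div_of_nonneg_left (by positivity) hKpos hden
    _ ≤ 6 * Real.exp (-((b - a) / ⌈(b - a) * Real.sqrt M⌉₊ * Real.sqrt M +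
          M * ((b - a) / ⌈(b - a) * Real.sqrt M⌉₊) ^ 2)) /
          ((((⌈(b - a) * Real.sqrt M⌉₊ : ℕ) : ℝ) + 1) * (((⌈(b - a) * Real.sqrt M⌉₊ : ℕ) : ℝ) + 2)) := by
        gcongr

end Optimal


/-! ## §2 Two dimensions: exactly diffusive with volume-uniform constants -/

section TwoDim

variable {L N : ℕ} [NeZero L] {G : Type*} [Group G] [TopologicalSpace G] [IsTopologicalGroup G]
  [CompactSpace G] [MeasurableSpace G] [BorelSpace G] [SecondCountableTopology G]
  (ρ : G →* Matrix (Fin N) (Fin N) ℂ)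

/-- **IN TWO DIMENSIONS SIMULATED TEMPERING OF THE WILSON MEASURE IS EXACTLY DIFFUSIVE IN THE COUPLING, FOR EVERY
COMPACT GAUGE GROUP** (`L ≥ 2`, continuous `ρ`, `−B ≤ a < b ≤ B`, `K ≥ 1`, `Δ = (b−a)/K`, `M k` any Markov kernels;
`m₂ = e^{−4NB}(L²−1)Var_Haar(Re tr ρ)/2 − N²`, `M₂ = 2N²e^{2NB}L²`):
`6·e^{−(Δ√M₂ + M₂Δ²)}/((K+1)(K+2)) ≤ 1 − ρ_lev(1) ≤ 6·e^{−m₂Δ²/8}/((K+1)(K+2))` for the sampler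
`stWithinLevel M ∘ₖ stLevelKernel`. [ours] -/
theorem wilson_stScan_one_sub_lagOneAutocorr_twoSided_twoDim (hL : 2 ≤ L) (hρ : Continuous ρ) {a b B : ℝ}
    (ha : -B ≤ a) (hab : a < b) (hb : b ≤ B) {K : ℕ} (hK : 1 ≤ K)
    (M : Fin (K + 1) → Kernel (GaugeConfig 2 L G) (GaugeConfig 2 L G)) [∀ k, IsMarkovKernel (M k)] :
    6 * Real.exp (-((b - a) / K * Real.sqrt (2 * (N : ℝ) ^ 2 * Real.exp (2 * N * B) * (L : ℝ) ^ 2) +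
        2 * (N : ℝ) ^ 2 * Real.exp (2 * N * B) * (L : ℝ) ^ 2 * ((b - a) / K) ^ 2)) / ((K + 1) * (K + 2)) ≤
      1 - (autocov (stWithinLevel M ∘ₖ stLevelKernel (measurable_neg_wilsonAction ρ hρ) (trivialMeasure G 2 L)
            (fun k => a + k * ((b - a) / K)) K)
          (stTarget (fun U => -wilsonAction ρ U) (trivialMeasure G 2 L) (fun k => a + k * ((b - a) / K)) K)
          (fun z => (((z.1 : Fin (K + 1)) : ℕ) : ℝ)) 1 - ((K : ℝ) / 2) ^ 2) / (K * (K + 2) / 12) ∧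
    1 - (autocov (stWithinLevel M ∘ₖ stLevelKernel (measurable_neg_wilsonAction ρ hρ) (trivialMeasure G 2 L)
            (fun k => a + k * ((b - a) / K)) K)
          (stTarget (fun U => -wilsonAction ρ U) (trivialMeasure G 2 L) (fun k => a + k * ((b - a) / K)) K)
          (fun z => (((z.1 : Fin (K + 1)) : ℕ) : ℝ)) 1 - ((K : ℝ) / 2) ^ 2) / (K * (K + 2) / 12) ≤
      6 * Real.exp (-((Real.exp (-(4 * N * B)) * ((L : ℝ) ^ 2 - 1) *
        variance (fun g : G => (ρ g).trace.re) (haarProbability G) / 2 - (N : ℝ) ^ 2) * (b - a) ^ 2 / (8 * K ^ 2))) /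
        ((K + 1) * (K + 2)) := by
  haveI : IsProbabilityMeasure (trivialMeasure G 2 L) := trivialMeasure_isProbabilityMeasure
  have hL1 : (0 : ℝ) ≤ (L : ℝ) ^ 2 - 1 := by
    have : (2 : ℝ) ≤ L := by exact_mod_cast hL
    nlinarith
  have hv : 0 ≤ variance (fun g : G => (ρ g).trace.re) (haarProbability G) := variance_nonneg _ _
  have hN : (0 : ℝ) ≤ N := Nat.cast_nonneg _
  -- GEN-12's pinched floor on `[a,b] ⊆ [−B,B]`
  have hfloor : ∀ u ∈ Icc a b, Real.exp (-(4 * N * B)) * ((L : ℝ) ^ 2 - 1) *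
      variance (fun g : G => (ρ g).trace.re) (haarProbability G) / 2 - (N : ℝ) ^ 2 ≤
      variance (fun U => -wilsonAction ρ U) ((trivialMeasure G 2 L).tilted fun U => u * (-wilsonAction ρ U)) := by
    intro u hu
    rw [tilted_neg_wilsonAction_eq ρ hρ u, variance_fun_neg]
    refine le_trans ?_ (wilson_variance_ge_twoDim (L := L) ρ hL hρ u)
    have hu' : |u| ≤ B := abs_le.2 ⟨by linarith [hu.1], by linarith [hu.2]⟩
    have hexp : Real.exp (-(4 * N * B)) ≤ Real.exp (-(4 * N * |u|)) := by
      apply Real.exp_le_exp.2; nlinarith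
    have := mul_le_mul_of_nonneg_right (mul_le_mul_of_nonneg_right hexp hL1) hv
    linarith
  -- GEN-12's ceiling on `[a,b] ⊆ [−B,B]`
  have hceil : ∀ u ∈ Icc a b, variance (fun U => -wilsonAction ρ U)
      ((trivialMeasure G 2 L).tilted fun U => u * (-wilsonAction ρ U)) ≤
      2 * (N : ℝ) ^ 2 * Real.exp (2 * N * B) * (L : ℝ) ^ 2 := by
    intro u hu
    rw [tilted_neg_wilsonAction_eq ρ hρ u, variance_fun_neg]
    refine (wilson_variance_le_twoDim (L := L) ρ hL hρ u).trans ?_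
    have hu' : |u| ≤ B := abs_le.2 ⟨by linarith [hu.1], by linarith [hu.2]⟩
    have hexp : Real.exp (2 * N * |u|) ≤ Real.exp (2 * N * B) := by
      apply Real.exp_le_exp.2; nlinarith
    have hL2 : (0 : ℝ) ≤ (L : ℝ) ^ 2 := by positivity
    have hN2 : (0 : ℝ) ≤ 2 * (N : ℝ) ^ 2 := by positivity
    exact mul_le_mul_of_nonneg_right (mul_le_mul_of_nonneg_left hexp hN2) hL2
  exact stScan_one_sub_lagOneAutocorr_twoSided (μ := trivialMeasure G 2 L) (measurable_neg_wilsonAction ρ hρ)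
    (neg_wilsonAction_bounded ρ hρ) hab hfloor hceil hK M

end TwoDim

/-! ## §3 The sampler is never frozen: `ā_K > 0`, so `ρ_lev(1) < 1` -/

section Positive

variable {Ω : Type*} [MeasurableSpace Ω] {X : Ω → ℝ} {μ : Measure Ω} [IsProbabilityMeasure μ] {β : ℕ → ℝ} {K : ℕ}

/-- **Adjacent overlaps are strictly positive**: `0 < ∫ min(p_s, p_t) dμ` for a bounded observable on a
probability space (both tilted densities are bounded below by a positive constant). [ours] -/
theorem st_overlap_pos (hXm : Measurable X) (hXb : ∃ C, ∀ x, |X x| ≤ C) (s t : ℝ) :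
    0 < ∫ x, min (Real.exp (s * X x) / mgf X μ s) (Real.exp (t * X x) / mgf X μ t) ∂μ := by
  obtain ⟨C, hC⟩ := hXb
  have hms : 0 < mgf X μ s := mgf_pos_of_bounded hXm ⟨C, hC⟩ s
  have hmt : 0 < mgf X μ t := mgf_pos_of_bounded hXm ⟨C, hC⟩ t
  -- uniform positive lower bound `c` for the integrand
  set c : ℝ := min (Real.exp (-(|s| * C)) / mgf X μ s) (Real.exp (-(|t| * C)) / mgf X μ t) with hc
  have hc0 : 0 < c := lt_min (div_pos (Real.exp_pos _) hms) (div_pos (Real.exp_pos _) hmt)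
  have hlow : ∀ x, c ≤ min (Real.exp (s * X x) / mgf X μ s) (Real.exp (t * X x) / mgf X μ t) := by
    intro x
    have h1 : Real.exp (-(|s| * C)) ≤ Real.exp (s * X x) := by
      apply Real.exp_le_exp.2
      have := neg_abs_le (s * X x)
      have h' : |s * X x| ≤ |s| * C := by rw [abs_mul]; exact mul_le_mul_of_nonneg_left (hC x) (abs_nonneg _)
      linarith
    have h2 : Real.exp (-(|t| * C)) ≤ Real.exp (t * X x) := by
      apply Real.exp_le_exp.2
      have := neg_abs_le (t * X x)
      have h' : |t * X x| ≤ |t| * C := by rw [abs_mul]; exact mul_le_mul_of_nonneg_left (hC x) (abs_nonneg _)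
      linarith
    exact le_min ((min_le_left _ _).trans (div_le_div_of_nonneg_right h1 hms.le))
      ((min_le_right _ _).trans (div_le_div_of_nonneg_right h2 hmt.le))
  have hint : Integrable (fun x => min (Real.exp (s * X x) / mgf X μ s) (Real.exp (t * X x) / mgf X μ t)) μ := by
    refine Integrable.of_bound ((((Real.measurable_exp.comp (hXm.const_mul s)).div_const _).min
      ((Real.measurable_exp.comp (hXm.const_mul t)).div_const _)).aestronglyMeasurable)
      (Real.exp (|s| * C) / mgf X μ s) (ae_of_all _ fun x => ?_)
    have hp : 0 ≤ min (Real.exp (s * X x) / mgf X μ s) (Real.exp (t * X x) / mgf X μ t) := hc0.le.trans (hlow x)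
    rw [Real.norm_eq_abs, abs_of_nonneg hp]
    refine (min_le_left _ _).trans (div_le_div_of_nonneg_right (Real.exp_le_exp.2 ?_) hms.le)
    have h' : |s * X x| ≤ |s| * C := by rw [abs_mul]; exact mul_le_mul_of_nonneg_left (hC x) (abs_nonneg _)
    linarith [le_abs_self (s * X x)]
  calc (0 : ℝ) < c := hc0
    _ = ∫ _x, c ∂μ := by rw [integral_const, probReal_univ, one_smul]
    _ ≤ _ := integral_mono (integrable_const c) hint hlow

/-- **`ā_K > 0` for `K ≥ 1`.** [ours] -/
theorem st_abar_pos (hXm : Measurable X) (hXb : ∃ C, ∀ x, |X x| ≤ C) (hK : 1 ≤ K) :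
    0 < 2 / (K + 1) * ∑ k ∈ range K, ∫ x, min (Real.exp (β k * X x) / mgf X μ (β k))
        (Real.exp (β (k + 1) * X x) / mgf X μ (β (k + 1))) ∂μ := by
  refine mul_pos (by positivity) (Finset.sum_pos (fun k _ => st_overlap_pos hXm hXb _ _) ?_)
  exact ⟨0, Finset.mem_range.2 (by omega)⟩

/-- **THE SAMPLER IS NEVER FROZEN AT LAG ONE**: `ρ_lev(1) < 1` for `W ∘ₖ L` (`K ≥ 1`; any Markov `M_k`) — the
`ρ(1) < 1` proviso of the `τ_int` floors holds for the constructed deterministic-scan sampler. [ours] -/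
theorem stScan_level_lagOneAutocorr_lt_one (hXm : Measurable X) (hXb : ∃ C, ∀ x, |X x| ≤ C) (hK : 1 ≤ K)
    (M : Fin (K + 1) → Kernel Ω Ω) [∀ k, IsMarkovKernel (M k)] :
    (autocov (stWithinLevel M ∘ₖ stLevelKernel hXm μ β K) (stTarget X μ β K)
          (fun z => (((z.1 : Fin (K + 1)) : ℕ) : ℝ)) 1 - ((K : ℝ) / 2) ^ 2) / (K * (K + 2) / 12) < 1 := by
  rw [stScan_level_lagOneAutocorr_eq hXm hXb hK M]
  have hKpos : (0 : ℝ) < K * (K + 2) := by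
    have : (1 : ℝ) ≤ K := by exact_mod_cast hK
    positivity
  have h := st_abar_pos (μ := μ) (β := β) hXm hXb hK
  have : 0 < 3 * (2 / (K + 1) * ∑ k ∈ range K, ∫ x, min (Real.exp (β k * X x) / mgf X μ (β k))
      (Real.exp (β (k + 1) * X x) / mgf X μ (β (k + 1))) ∂μ) / (K * (K + 2)) := by positivity
  linarith

end Positive

end Summit.Ventures.LatticeQCDFlow.Scaling

end
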